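import Literature.Analysis.FunctionSpaces.TorusFluidGlue
import Literature.Analysis.FunctionSpaces.TorusTestFunction
import Literature.Analysis.FunctionSpaces.TorusConvolution
import Literature.Analysis.FunctionSpaces.TorusCalculusProofs
import HarnessLib

/-!
# The squared `H¹` distance of smooth vector fields on the flat torus: symmetry and the
# parallelogram (quasi-triangle) bound

Function-space support file (all results proved; no definitions, no named facts). For smooth fields
`v, w : T^d → ℝ^d` the quantity

  `∫ ‖v − w‖² + ‖∇(v − w)‖₂²`   (`Torus.gradNormSq`, pointwise gradients)

is the squared `H¹` distance. This file records the two elementary facts used when such distances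
are chained through intermediate fields (continuous dependence on data, then a time shift, etc.):

* `Torus.integral_norm_sub_sq_comm`, `Torus.gradNormSq_sub_comm`, `Torus.h1DistSq_comm` — symmetry
  (unconditional: `‖a − b‖ = ‖b − a‖`, `∂ᵢ(−g) = −∂ᵢg`);
* `Torus.integral_norm_sub_sq_le_two_mul`, `Torus.gradNormSq_sub_le_two_mul`,
  `Torus.h1DistSq_le_two_mul` — the parallelogram bound `d(u,w)² ≤ 2 d(u,v)² + 2 d(v,w)²` for smooth
  fields (pointwise `‖a + b‖² ≤ 2‖a‖² + 2‖b‖²`, linearity of `∂ᵢ` on `C¹` fields, integrate).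

The statements are written with the lambda forms `fun x => v x - w x` under the integral and inside
`gradNormSq`, exactly as the squared distance is spelled by its users.

Tree: `Torus.gradNormSq` (`TorusFluidGlue`), `Torus.partialDeriv_add` (`TorusTestFunction`),
`Torus.partialDeriv_neg` (`TorusConvolution`), `Torus.IsSmooth.partialDeriv`, `IsSmooth.norm_sq`,
`Continuous.integrable_unitAddTorus`. Nothing named `h1Dist`/`sobolevDist` for pointwise gradients
(`lean search 'gradNormSq.*(sub|comm|triangle|two_mul)'`: none).
-/

open MeasureTheory Set

noncomputable section

namespace Literature.Analysis.FunctionSpaces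

namespace Torus

variable {d : Type*} [Fintype d] [DecidableEq d]

omit [DecidableEq d] in
/-- `∫ ‖v − w‖² = ∫ ‖w − v‖²`. [folklore] -/
theorem integral_norm_sub_sq_comm (v w : UnitAddTorus d → EuclideanSpace ℝ d) :
    ∫ x, ‖v x - w x‖ ^ 2 = ∫ x, ‖w x - v x‖ ^ 2 := by
  congr 1; funext x; rw [norm_sub_rev]

/-- `‖∇(v − w)‖₂² = ‖∇(w − v)‖₂²` (unconditionally: `∂ᵢ(−g) = −∂ᵢ g` for the pointwise partial
derivatives, junk values included). [folklore] -/
theorem gradNormSq_sub_comm (v w : UnitAddTorus d → EuclideanSpace ℝ d) :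
    gradNormSq (fun x => v x - w x) = gradNormSq (fun x => w x - v x) := by
  unfold gradNormSq
  congr 1; funext x
  refine Finset.sum_congr rfl fun i _ => ?_
  have h : (fun y => v y - w y) = fun y => -(fun z => w z - v z) y := by
    funext y; simp
  rw [h, partialDeriv_neg, norm_neg]

/-- Symmetry of the squared `H¹` distance `∫ ‖v − w‖² + ‖∇(v − w)‖₂²`. [folklore] -/
theorem h1DistSq_comm (v w : UnitAddTorus d → EuclideanSpace ℝ d) :
    (∫ x, ‖v x - w x‖ ^ 2) + gradNormSq (fun x => v x - w x) =
      (∫ x, ‖w x - v x‖ ^ 2) + gradNormSq (fun x => w x - v x) := by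
  rw [integral_norm_sub_sq_comm, gradNormSq_sub_comm]

omit [DecidableEq d] in
/-- Parallelogram bound in `L²`: `∫ ‖u − w‖² ≤ 2 ∫ ‖u − v‖² + 2 ∫ ‖v − w‖²` for continuous fields
(pointwise `‖a + b‖² ≤ 2‖a‖² + 2‖b‖²`, integrated over the probability space `T^d`). [folklore] -/
theorem integral_norm_sub_sq_le_two_mul {u v w : UnitAddTorus d → EuclideanSpace ℝ d}
    (hu : Continuous u) (hv : Continuous v) (hw : Continuous w) :
    ∫ x, ‖u x - w x‖ ^ 2 ≤ 2 * (∫ x, ‖u x - v x‖ ^ 2) + 2 * ∫ x, ‖v x - w x‖ ^ 2 := by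
  have hiA : Integrable (fun x => ‖u x - v x‖ ^ 2) :=
    (((hu.sub hv).norm).pow 2).integrable_unitAddTorus
  have hiB : Integrable (fun x => ‖v x - w x‖ ^ 2) :=
    (((hv.sub hw).norm).pow 2).integrable_unitAddTorus
  have hiC : Integrable (fun x => ‖u x - w x‖ ^ 2) :=
    (((hu.sub hw).norm).pow 2).integrable_unitAddTorus
  have hpt : ∀ x, ‖u x - w x‖ ^ 2 ≤ 2 * ‖u x - v x‖ ^ 2 + 2 * ‖v x - w x‖ ^ 2 := fun x => by
    have hx : ‖u x - w x‖ ≤ ‖u x - v x‖ + ‖v x - w x‖ := norm_sub_le_norm_sub_add_norm_sub _ _ _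
    have hx2 : ‖u x - w x‖ ^ 2 ≤ (‖u x - v x‖ + ‖v x - w x‖) ^ 2 :=
      pow_le_pow_left₀ (norm_nonneg _) hx 2
    nlinarith [sq_nonneg (‖u x - v x‖ - ‖v x - w x‖)]
  calc ∫ x, ‖u x - w x‖ ^ 2 ≤ ∫ x, (2 * ‖u x - v x‖ ^ 2 + 2 * ‖v x - w x‖ ^ 2) :=
        integral_mono hiC ((hiA.const_mul 2).add (hiB.const_mul 2)) hpt
    _ = 2 * (∫ x, ‖u x - v x‖ ^ 2) + 2 * ∫ x, ‖v x - w x‖ ^ 2 := by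
        rw [integral_add (hiA.const_mul 2) (hiB.const_mul 2), integral_const_mul, integral_const_mul]

/-- Parallelogram bound for the gradient seminorm: `‖∇(u − w)‖₂² ≤ 2‖∇(u − v)‖₂² + 2‖∇(v − w)‖₂²`
for smooth fields (`∂ᵢ(u − w) = ∂ᵢ(u − v) + ∂ᵢ(v − w)` pointwise, `Torus.partialDeriv_add`, then the
pointwise parallelogram bound, summed over `i` and integrated). [folklore] -/
theorem gradNormSq_sub_le_two_mul {u v w : UnitAddTorus d → EuclideanSpace ℝ d} (hu : IsSmooth u)
    (hv : IsSmooth v) (hw : IsSmooth w) :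
    gradNormSq (fun x => u x - w x) ≤
      2 * gradNormSq (fun x => u x - v x) + 2 * gradNormSq (fun x => v x - w x) := by
  have hA : IsSmooth (fun x => u x - v x) := hu.sub hv
  have hB : IsSmooth (fun x => v x - w x) := hv.sub hw
  have hsplit : (fun x => u x - w x) = (fun x => u x - v x) + fun x => v x - w x := by
    funext x; simp
  have hpd : ∀ i x, partialDeriv i (fun x => u x - w x) x =
      partialDeriv i (fun x => u x - v x) x + partialDeriv i (fun x => v x - w x) x := fun i x => by
    rw [hsplit, partialDeriv_add (hA.isContDiff (by simp)) (hB.isContDiff (by simp))]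
    rfl
  -- integrability of the three integrands
  have hint : ∀ {g : UnitAddTorus d → EuclideanSpace ℝ d}, IsSmooth g →
      Integrable (fun x => ∑ i, ‖partialDeriv i g x‖ ^ 2) := fun hg =>
    (continuous_finsetSum _ fun i _ => ((hg.partialDeriv i).continuous.norm).pow 2)
      |>.integrable_unitAddTorus
  have hpt : ∀ x, ∑ i, ‖partialDeriv i (fun x => u x - w x) x‖ ^ 2 ≤
      2 * ∑ i, ‖partialDeriv i (fun x => u x - v x) x‖ ^ 2 +
        2 * ∑ i, ‖partialDeriv i (fun x => v x - w x) x‖ ^ 2 := fun x => by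
    rw [Finset.mul_sum, Finset.mul_sum, ← Finset.sum_add_distrib]
    refine Finset.sum_le_sum fun i _ => ?_
    rw [hpd i x]
    set a := partialDeriv i (fun x => u x - v x) x
    set b := partialDeriv i (fun x => v x - w x) x
    have h1 : ‖a + b‖ ≤ ‖a‖ + ‖b‖ := norm_add_le a b
    have h2 : ‖a + b‖ ^ 2 ≤ (‖a‖ + ‖b‖) ^ 2 := pow_le_pow_left₀ (norm_nonneg _) h1 2
    nlinarith [sq_nonneg (‖a‖ - ‖b‖)]
  unfold gradNormSq
  calc ∫ x, ∑ i, ‖partialDeriv i (fun x => u x - w x) x‖ ^ 2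
      ≤ ∫ x, (2 * ∑ i, ‖partialDeriv i (fun x => u x - v x) x‖ ^ 2 +
          2 * ∑ i, ‖partialDeriv i (fun x => v x - w x) x‖ ^ 2) :=
        integral_mono (hint (hu.sub hw)) (((hint hA).const_mul 2).add ((hint hB).const_mul 2)) hpt
    _ = 2 * (∫ x, ∑ i, ‖partialDeriv i (fun x => u x - v x) x‖ ^ 2) +
          2 * ∫ x, ∑ i, ‖partialDeriv i (fun x => v x - w x) x‖ ^ 2 := by
        rw [integral_add ((hint hA).const_mul 2) ((hint hB).const_mul 2), integral_const_mul,
          integral_const_mul]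

/-- **Parallelogram bound for the squared `H¹` distance of smooth fields**:
`d(u, w)² ≤ 2 d(u, v)² + 2 d(v, w)²` with `d(v, w)² = ∫ ‖v − w‖² + ‖∇(v − w)‖₂²`. [folklore] -/
theorem h1DistSq_le_two_mul {u v w : UnitAddTorus d → EuclideanSpace ℝ d} (hu : IsSmooth u)
    (hv : IsSmooth v) (hw : IsSmooth w) :
    (∫ x, ‖u x - w x‖ ^ 2) + gradNormSq (fun x => u x - w x) ≤
      2 * ((∫ x, ‖u x - v x‖ ^ 2) + gradNormSq (fun x => u x - v x)) +
        2 * ((∫ x, ‖v x - w x‖ ^ 2) + gradNormSq (fun x => v x - w x)) := by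
  have h1 := integral_norm_sub_sq_le_two_mul hu.continuous hv.continuous hw.continuous
  have h2 := gradNormSq_sub_le_two_mul hu hv hw
  linarith

/-- Chaining through two intermediate fields (the parallelogram bound twice):
`d(u, w)² ≤ 2 d(u, v₁)² + 4 d(v₁, v₂)² + 4 d(v₂, w)²`. [folklore] -/
theorem h1DistSq_le_three_points {u v₁ v₂ w : UnitAddTorus d → EuclideanSpace ℝ d}
    (hu : IsSmooth u) (hv₁ : IsSmooth v₁) (hv₂ : IsSmooth v₂) (hw : IsSmooth w) :
    (∫ x, ‖u x - w x‖ ^ 2) + gradNormSq (fun x => u x - w x) ≤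
      2 * ((∫ x, ‖u x - v₁ x‖ ^ 2) + gradNormSq (fun x => u x - v₁ x)) +
        4 * ((∫ x, ‖v₁ x - v₂ x‖ ^ 2) + gradNormSq (fun x => v₁ x - v₂ x)) +
          4 * ((∫ x, ‖v₂ x - w x‖ ^ 2) + gradNormSq (fun x => v₂ x - w x)) := by
  have h1 := h1DistSq_le_two_mul hu hv₁ hw
  have h2 := h1DistSq_le_two_mul hv₁ hv₂ hw
  have h0 : 0 ≤ ∫ x, ‖v₁ x - v₂ x‖ ^ 2 := integral_nonneg fun x => sq_nonneg _
  nlinarith [gradNormSq_nonneg (fun x => v₁ x - v₂ x)]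

end Torus

end Literature.Analysis.FunctionSpaces
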